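import Literature.Computability.AlgebraicComplexity.ChowHighestWeight
import Literature.Computability.AlgebraicComplexity.Polarization
import HarnessLib

/-!
# The plethysm bridge `k[Sym^δ k^N]_N ≅ 𝒪(V^N // H_N)_δ = Sym^N Sym^δ V^*`

Setting of `ChowPullback.lean` … `ChowHighestWeight.lean` (`k[Mat_N] = MvPolynomial (Fin N × Fin N) k`
with the action `formsRep N` of `GL_N`, the generic linear forms `ℓ_r = ∑_i X_{(i,r)} X_i`, the
graded pieces `symBalanced N δ = 𝒪(V^N // H_N)_δ` of balanced form-symmetric polynomials, and
`IsRealized k N δ ψ`: a nonzero highest-weight vector of weight `ψ` in `symBalanced N δ`) and of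
`OrbitCoordinateRing.lean` (`coordRep (Fin N) k δ`, the action of `GL_N` on the polynomial functions
`k[Sym^δ k^N] = MvPolynomial (DegIdx (Fin N) δ) k` on forms of degree `δ`).

The tree uses TWO models of the statement "`V(λ)` occurs in `Sym^N Sym^δ V`" (Bürgisser–Hüttenhain–
Ikenmeyer, Proc. AMS 145 (2017) = arXiv:1501.05528, §3, Lemma 4: "`S(V^n // H_n) = {λ | n divides |λ|`
`and V_G(λ) occurs in Sym^n Sym^{|λ|/n} ℂ^n}`", from (5) `𝒪(V^n // H_n) ≃ ⊕_k Sym^n Sym^k V^*`):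
a highest-weight vector of the dual weight among the forms of degree `N` on `Sym^δ V`
(`coordRep`-model; `symSymOcc` of `Literature/Barriers/ValiantsHypothesis/NotViaSaturationsChowNormal.lean`),
or a highest-weight vector in `𝒪(V^N // H_N)_δ` (`formsRep`-model, `IsRealized`). This file proves
that they agree (`isRealized_of_mem_highestWeightSpace_coordRep`,
`exists_mem_highestWeightSpace_coordRep_of_isRealized`) by an explicit `GL_N`-equivariant
isomorphism `k[Sym^δ k^N]_N = Sym^N (Sym^δ V)^* ≅ Sym^N Sym^δ V^* = 𝒪(V^N // H_N)_δ` and its inverse: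

* `plethysmBridge N δ` (`Θ`): `Θ(F) = ∑_J A(F)_J · ∏_r coeff_{J r}(ℓ_r^δ)`, the full polarisation
  of the degree-`N` form `F` (its symmetric array `A(F) = arrOf N F`, `Hyperdeterminant.lean`)
  evaluated at the Veronese points `ℓ_0^δ, …, ℓ_{N-1}^δ` (`veronesePullback N δ r`, the generic orbit
  map of `X_r^δ`: `X_e ↦ coeff_e(ℓ_r^δ) = multinomial(e) x_r^e`); explicitly
  `Θ(F) = ∑_J A(F)_J · multCoef J · x^{M_J}` with `M_J` the exponent matrix with columns `J r`
  (`plethysmBridge_eq_sum_monomial`) — diagonal in the monomial bases;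
* `plethysmRestitution N δ` (`Ξ`): `Ξ(G) = ∑_J (coeff_{M_J}(G) / multCoef J) · X_{J 0} ⋯ X_{J (N-1)}`;
* PROVED: `Ξ ∘ Θ = id` on forms of degree `N` (`plethysmRestitution_plethysmBridge`, a form is the
  symmetrisation of its array), `Θ ∘ Ξ = id` on `symBalanced N δ`
  (`plethysmBridge_plethysmRestitution`: form-symmetry makes the array of `Ξ(G)` the coefficients of
  `G`, balancedness makes every monomial of `G` an `x^{M_J}`), `Θ(F) ∈ symBalanced N δ`, and the
  EQUIVARIANCE `Θ(g · F) = g · Θ(F)` (`plethysmBridge_coordSubst`: the transformation law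
  `arrOf_linSubst` of the array against the equivariance of the Veronese pullbacks, itself the
  general equivariance `genericOrbitMap_coordSubst` of generic orbit maps `F ↦ F(Y · f)`); hence
  highest-weight vectors correspond (`plethysmBridge_mem_highestWeightSpace`,
  `plethysmRestitution_mem_highestWeightSpace`);
* also: highest-weight vectors of a coordinate ring `k[Δ_m[f]]` lift to highest-weight vectors of
  `k[Sym^m]` outside the ideal (`exists_mem_highestWeightSpace_not_mem_of_hasHighestWeight`, by
  complete reducibility), the form of BHI's §1 remark after (1) used downstream.

Characteristic zero is used for the division by multinomial coefficients and fibre sizes and for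
complete reducibility; nothing is specific to `k = ℂ`. The discharges of BHI's Prop. 1 for the Chow
variety built on this bridge are in
`Literature/Barriers/ValiantsHypothesis/NotViaSaturationsChowNormalProofs.lean`.

## References

* [BurgisserHuttenhainIkenmeyer2017] §3, Lemma 4 and (5); §1 (the remark after (1)).
* J. M. Landsberg, arXiv:1305.7387, §7.2 (polarisation and the Hermite–Hadamard–Howe map). [folklore]
-/

noncomputable section

open MvPolynomial
open scoped Matrix

namespace Literature.Computability.AlgebraicComplexity

open Literature.NumberTheory.DiophantineGeometry Literature.Computability.Complexity

variable {k : Type*} [Field k] {N δ : ℕ}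

/-! ### Equivariance of generic orbit maps -/

/-- **Generic orbit maps are `GL`-equivariant.** For any polynomial `f` in the `N` variables, the
generic orbit map `F ↦ F(Y · f)` (`genericOrbitMap f δ`, `Y` the generic `N × N` matrix) intertwines
the action `coordRep` on `k[Sym^δ k^N]` with the action `formsRep` on `k[Mat_N]`:
`F(g⁻¹ · (Y · f)) = F((g⁻¹ Y) · f)` (checked on values at every matrix, over an infinite field; the
case `f = X_0 ⋯ X_{N-1}` is `chowPullback_coordSubst`). [folklore] -/
theorem genericOrbitMap_coordSubst [Infinite k] (f : MvPolynomial (Fin N) k) (g : GL (Fin N) k)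
    (F : MvPolynomial (DegIdx (Fin N) δ) k) :
    genericOrbitMap f δ (coordSubst δ g F) = formsRep N g (genericOrbitMap f δ F) := by
  apply MvPolynomial.funext
  intro w
  have hw : ∀ w' : Fin N × Fin N → k,
      w' = fun ij : Fin N × Fin N => (Matrix.of fun i j => w' (i, j)) ij.1 ij.2 := fun w' => by
    funext ij
    rw [Matrix.of_apply]
  rw [eval_formsRep]
  conv_lhs => rw [hw w]
  rw [eval_genericOrbitMap, aeval_formCoeff_coordSubst, linSubstRep_apply, ← AlgHom.comp_apply,
    ← linSubst_mul]
  conv_rhs => rw [hw (fun v : Fin N × Fin N =>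
    ∑ i : Fin N, ((g⁻¹ : GL (Fin N) k) : Matrix (Fin N) (Fin N) k) v.1 i * w (i, v.2))]
  rw [eval_genericOrbitMap]
  congr 3

/-! ### The Veronese pullbacks `X_e ↦ coeff_e (ℓ_r^δ)` -/

variable (N δ) in
/-- **The Veronese pullback in the `r`-th form**: the `k`-algebra map `k[Sym^δ k^N] → k[Mat_N]`,
`F ↦ F(ℓ_r^δ)`, sending the coordinate `X_e` to the coefficient of `X^e` in the `δ`-th power of the
`r`-th generic linear form `ℓ_r = ∑_i X_{(i,r)} X_i` — the comorphism of `v ↦ v^δ` on the `r`-th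
copy of `V` in `V^N`; it is the generic orbit map of `X_r^δ`. [folklore] -/
def veronesePullback (r : Fin N) :
    MvPolynomial (DegIdx (Fin N) δ) k →ₐ[k] MvPolynomial (Fin N × Fin N) k :=
  genericOrbitMap (X r ^ δ : MvPolynomial (Fin N) k) δ

/-- The Veronese pullback of a coordinate is a coefficient of `ℓ_r^δ`. [folklore] -/
theorem veronesePullback_X (r : Fin N) (e : DegIdx (Fin N) δ) :
    veronesePullback (k := k) N δ r (X e) = coeff e.1 (genericLinForm (k := k) N r ^ δ) := by
  unfold veronesePullback genericOrbitMap
  rw [aeval_X, map_pow, map_X, map_pow, linSubst_X, genericLinForm]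
  congr 2
  refine Finset.sum_congr rfl fun i _ => ?_
  rw [Matrix.mvPolynomialX_apply, smul_eq_C_mul]

/-- The Veronese pullbacks are `GL_N`-equivariant. [folklore] -/
theorem veronesePullback_coordSubst [Infinite k] (r : Fin N) (g : GL (Fin N) k)
    (F : MvPolynomial (DegIdx (Fin N) δ) k) :
    veronesePullback N δ r (coordSubst δ g F) = formsRep N g (veronesePullback N δ r F) :=
  genericOrbitMap_coordSubst _ g F

/-- **The coefficients of `ℓ_r^δ`** (multinomial theorem): the coefficient of `X^e` (`|e| = δ`) is
`multinomial(e) · ∏_i X_{(i,r)}^{e_i}`. [folklore] -/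
theorem coeff_genericLinForm_pow (r : Fin N) (e : DegIdx (Fin N) δ) :
    coeff e.1 (genericLinForm (k := k) N r ^ δ) =
      (e.1.multinomial : MvPolynomial (Fin N × Fin N) k) *
        ∏ i : Fin N, (X (i, r) : MvPolynomial (Fin N × Fin N) k) ^ (e.1 i) := by
  have hform : genericLinForm (k := k) N r =
      ∑ i : Fin N, (X (i, r) : MvPolynomial (Fin N × Fin N) k) • X i := by
    simp only [genericLinForm, smul_eq_C_mul]
  have hdeg : e.1.sum (fun _ m => m) = δ := by
    have h := mem_degMonomials_iff.mp e.2
    rwa [Finsupp.degree_apply] at h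
  rw [hform, coeff_linearCombination_X_pow_of_fintype, if_pos hdeg]
  congr 1
  exact Finsupp.prod_fintype _ _ fun i => pow_zero _

/-! ### Column exponent matrices -/

/-- The exponent matrix `M_J ∈ ℕ^{N × N}` whose `r`-th column is the exponent vector `J r`
(`|J r| = δ`): the exponent of the monomial `∏_r x_r^{J r}` of `k[Mat_N]`. [folklore] -/
def colExp (J : Fin N → DegIdx (Fin N) δ) : Fin N × Fin N →₀ ℕ :=
  Finsupp.equivFunOnFinite.symm fun v => (J v.2).1 v.1

/-- Unfolding of `colExp`. [folklore] -/
@[simp]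
theorem colExp_apply (J : Fin N → DegIdx (Fin N) δ) (v : Fin N × Fin N) :
    colExp J v = (J v.2).1 v.1 := by
  simp [colExp]

/-- `J ↦ M_J` is injective. [folklore] -/
theorem colExp_injective : Function.Injective (colExp (N := N) (δ := δ)) := by
  intro J J' h
  funext r
  apply Subtype.ext
  ext i
  have := congrArg (fun s => s (i, r)) h
  simpa using this

/-- The column sums of `M_J` are all `δ`. [folklore] -/
theorem sum_colExp_apply (J : Fin N → DegIdx (Fin N) δ) (r : Fin N) :
    ∑ i : Fin N, colExp J (i, r) = δ := by
  simp only [colExp_apply]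
  rw [← Finsupp.degree_eq_sum]
  exact mem_degMonomials_iff.mp (J r).2

/-- `∏_r ∏_i X_{(i,r)}^{(J r)_i}` is the monomial with exponent matrix `M_J`. [folklore] -/
theorem prod_prod_X_pow_eq_monomial_colExp (J : Fin N → DegIdx (Fin N) δ) :
    ∏ r : Fin N, ∏ i : Fin N, (X (i, r) : MvPolynomial (Fin N × Fin N) k) ^ ((J r).1 i) =
      monomial (colExp J) 1 := by
  rw [monomial_eq, C_1, one_mul, Finsupp.prod_fintype _ _ (fun v => pow_zero _),
    Fintype.prod_prod_type_right]
  simp only [colExp_apply]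

/-- The product of the multinomial coefficients of the columns of `M_J` (a positive integer).
[folklore] -/
def multCoef (J : Fin N → DegIdx (Fin N) δ) : ℕ :=
  ∏ r : Fin N, (J r).1.multinomial

/-- `multCoef J` is positive. [folklore] -/
theorem multCoef_pos (J : Fin N → DegIdx (Fin N) δ) : 0 < multCoef J :=
  Finset.prod_pos fun r _ => by
    rw [Finsupp.multinomial_eq]
    exact Nat.multinomial_pos _ _

/-- `multCoef J ≠ 0` in characteristic zero. [folklore] -/
theorem multCoef_ne_zero [CharZero k] (J : Fin N → DegIdx (Fin N) δ) : (multCoef J : k) ≠ 0 :=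
  Nat.cast_ne_zero.mpr (multCoef_pos J).ne'

/-- **The product of the Veronese pullbacks of the letters of `J`** is `multCoef J · x^{M_J}`.
[folklore] -/
theorem prod_veronesePullback_X (J : Fin N → DegIdx (Fin N) δ) :
    ∏ r : Fin N, veronesePullback (k := k) N δ r (X (J r)) = monomial (colExp J) (multCoef J : k) := by
  simp_rw [veronesePullback_X, coeff_genericLinForm_pow]
  rw [Finset.prod_mul_distrib, prod_prod_X_pow_eq_monomial_colExp, multCoef, Nat.cast_prod]
  have h : (∏ x : Fin N, ((J x).1.multinomial : MvPolynomial (Fin N × Fin N) k)) =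
      C (∏ x : Fin N, ((J x).1.multinomial : k)) := by
    rw [map_prod]
    exact Finset.prod_congr rfl fun r _ => (map_natCast C _).symm
  rw [h, C_mul_monomial, mul_one]

/-! ### Permuting the forms -/

/-- Permuting the columns of `M_J` by `τ` gives `M_{J ∘ τ⁻¹}`. [folklore] -/
theorem mapDomain_prodMap_colExp (τ : Equiv.Perm (Fin N)) (J : Fin N → DegIdx (Fin N) δ) :
    Finsupp.mapDomain (Prod.map id ⇑τ) (colExp J) = colExp (J ∘ ⇑τ.symm) := by
  have hinj : Function.Injective (Prod.map id ⇑τ : Fin N × Fin N → Fin N × Fin N) :=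
    Function.Injective.prodMap Function.injective_id τ.injective
  ext v
  have hv : v = Prod.map id ⇑τ (v.1, τ.symm v.2) := by simp
  rw [hv, Finsupp.mapDomain_apply hinj]
  simp

/-- `multCoef` is invariant under permuting the letters. [folklore] -/
theorem multCoef_comp_perm (J : Fin N → DegIdx (Fin N) δ) (π : Equiv.Perm (Fin N)) :
    multCoef (J ∘ ⇑π) = multCoef J :=
  Fintype.prod_equiv π _ _ fun _ => rfl

/-- For a form-symmetric `G`, the coefficient of `x^{M_J}` only depends on `J` up to permuting the
letters. [folklore] -/
theorem coeff_colExp_comp_perm {G : MvPolynomial (Fin N × Fin N) k} (hG : IsFormSymm N G)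
    (J : Fin N → DegIdx (Fin N) δ) (π : Equiv.Perm (Fin N)) :
    coeff (colExp (J ∘ ⇑π)) G = coeff (colExp J) G := by
  have hinj : Function.Injective (Prod.map id ⇑π.symm : Fin N × Fin N → Fin N × Fin N) :=
    Function.Injective.prodMap Function.injective_id π.symm.injective
  have h := mapDomain_prodMap_colExp π.symm J
  rw [Equiv.symm_symm] at h
  rw [← h]
  conv_lhs => rw [← hG π.symm]
  exact coeff_rename_mapDomain _ hinj _ _

/-! ### The bridge `Θ : k[Sym^δ k^N]_N → 𝒪(V^N // H_N)_δ` and its inverse -/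

variable (N δ) in
/-- **The plethysm bridge** `Θ : k[Sym^δ k^N] → k[Mat_N]`,
`Θ(F) = ∑_J A(F)_J · ∏_r coeff_{J r}(ℓ_r^δ)`, where `A(F)` is the symmetric `N`-array of the
degree-`N` form `F` in the coordinates `X_e` (`arrOf`): the full polarisation of `F` evaluated at the
`δ`-th powers `ℓ_0^δ, …, ℓ_{N-1}^δ` of the `N` generic linear forms, i.e. (up to the factor `N!`) the
multilinear part of `F(ℓ_0^δ + ⋯ + ℓ_{N-1}^δ)`. It realises the isomorphism of `GL_N`-modules
`k[Sym^δ V]_N = Sym^N (Sym^δ V)^* ≅ Sym^N Sym^δ V^* = 𝒪(V^N // H_N)_δ` (BHI (5), Lemma 4) between the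
two models of "`λ` occurs in `Sym^N Sym^δ V`" used in the tree (`coordRep` on polynomial functions on
forms, `formsRep` on balanced form-symmetric polynomials on `Mat_N`).
[cite: BurgisserHuttenhainIkenmeyer2017, §3 (Lemma 4 and (5))] -/
def plethysmBridge (F : MvPolynomial (DegIdx (Fin N) δ) k) : MvPolynomial (Fin N × Fin N) k :=
  ∑ J : Fin N → DegIdx (Fin N) δ, C (arrOf N F J) * ∏ r : Fin N, veronesePullback N δ r (X (J r))

/-- `Θ(F) = ∑_J A(F)_J · multCoef J · x^{M_J}`. [folklore] -/
theorem plethysmBridge_eq_sum_monomial (F : MvPolynomial (DegIdx (Fin N) δ) k) :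
    plethysmBridge N δ F =
      ∑ J : Fin N → DegIdx (Fin N) δ, monomial (colExp J) (arrOf N F J * (multCoef J : k)) := by
  unfold plethysmBridge
  refine Finset.sum_congr rfl fun J _ => ?_
  rw [prod_veronesePullback_X, C_mul_monomial]

/-- The coefficient of `x^{M_J}` in `Θ(F)` is `A(F)_J · multCoef J`. [folklore] -/
theorem coeff_colExp_plethysmBridge (F : MvPolynomial (DegIdx (Fin N) δ) k)
    (J : Fin N → DegIdx (Fin N) δ) :
    coeff (colExp J) (plethysmBridge N δ F) = arrOf N F J * (multCoef J : k) := by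
  classical
  rw [plethysmBridge_eq_sum_monomial, coeff_sum, Finset.sum_eq_single J]
  · rw [coeff_monomial, if_pos rfl]
  · intro J' _ hJ'
    rw [coeff_monomial, if_neg fun h => hJ' (colExp_injective h)]
  · intro h
    exact absurd (Finset.mem_univ J) h

/-- `Θ` is homogeneous: `Θ(c F) = c Θ(F)`. [folklore] -/
theorem plethysmBridge_smul (c : k) (F : MvPolynomial (DegIdx (Fin N) δ) k) :
    plethysmBridge N δ (c • F) = c • plethysmBridge N δ F := by
  rw [plethysmBridge_eq_sum_monomial, plethysmBridge_eq_sum_monomial, Finset.smul_sum]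
  refine Finset.sum_congr rfl fun J _ => ?_
  rw [smul_monomial, smul_eq_mul, ← mul_assoc]
  congr 2
  simp only [arrOf, coeff_smul, smul_eq_mul, mul_div_assoc]

/-- `Θ(0) = 0`. [folklore] -/
theorem plethysmBridge_zero : plethysmBridge (k := k) N δ 0 = 0 := by
  have h := plethysmBridge_smul (N := N) (δ := δ) (0 : k) 0
  rwa [zero_smul, zero_smul] at h

variable (N δ) in
/-- **The restitution** `Ξ : k[Mat_N] → k[Sym^δ k^N]_N`,
`Ξ(G) = ∑_J (coeff_{M_J}(G) / multCoef J) · X_{J 0} ⋯ X_{J (N-1)}`: the inverse of the plethysm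
bridge on balanced form-symmetric polynomials (`plethysmBridge_plethysmRestitution`,
`plethysmRestitution_plethysmBridge`). [folklore] -/
def plethysmRestitution (G : MvPolynomial (Fin N × Fin N) k) : MvPolynomial (DegIdx (Fin N) δ) k :=
  ∑ J : Fin N → DegIdx (Fin N) δ, C (coeff (colExp J) G / (multCoef J : k)) * ∏ r : Fin N, X (J r)

/-- `Ξ(G)` is a form of degree `N`. [folklore] -/
theorem isHomogeneous_plethysmRestitution (G : MvPolynomial (Fin N × Fin N) k) :
    (plethysmRestitution N δ G).IsHomogeneous N := by
  refine IsHomogeneous.sum _ _ _ fun J _ => ?_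
  rw [prod_X_eq_monomial_wordExp, C_mul_monomial, mul_one]
  exact isHomogeneous_monomial _ (degree_wordExp J)

/-- **`Ξ ∘ Θ = id` on forms of degree `N`** (characteristic zero): a form is the symmetrisation of
its array (`sum_arrOf_mul_prod_X`). [folklore] -/
theorem plethysmRestitution_plethysmBridge [CharZero k] {F : MvPolynomial (DegIdx (Fin N) δ) k}
    (hF : F.IsHomogeneous N) : plethysmRestitution N δ (plethysmBridge N δ F) = F := by
  unfold plethysmRestitution
  simp_rw [coeff_colExp_plethysmBridge, mul_div_cancel_right₀ _ (multCoef_ne_zero (k := k) _)]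
  exact sum_arrOf_mul_prod_X hF

/-- Hence **`Θ` is injective on forms of degree `N`**: `Θ(F) ≠ 0` for `F ≠ 0`. [folklore] -/
theorem plethysmBridge_ne_zero [CharZero k] {F : MvPolynomial (DegIdx (Fin N) δ) k}
    (hF : F.IsHomogeneous N) (hF0 : F ≠ 0) : plethysmBridge N δ F ≠ 0 := by
  intro h
  apply hF0
  rw [← plethysmRestitution_plethysmBridge hF, h]
  unfold plethysmRestitution
  simp

/-- The array of `Ξ(G)` for a form-symmetric `G` (characteristic zero): `A(Ξ G)_J =
coeff_{M_J}(G) / multCoef J` (a symmetric array, `arrOf_sum_C_mul_prod_X`). [folklore] -/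
theorem arrOf_plethysmRestitution [CharZero k] {G : MvPolynomial (Fin N × Fin N) k}
    (hG : IsFormSymm N G) (J : Fin N → DegIdx (Fin N) δ) :
    arrOf N (plethysmRestitution N δ G) J = coeff (colExp J) G / (multCoef J : k) := by
  unfold plethysmRestitution
  rw [arrOf_sum_C_mul_prod_X]
  intro I π
  rw [coeff_colExp_comp_perm hG, multCoef_comp_perm]

/-- The columns of a balanced exponent matrix. [folklore] -/
def expMatrixCol (s : Fin N × Fin N →₀ ℕ) (r : Fin N) : Fin N →₀ ℕ :=
  Finsupp.equivFunOnFinite.symm fun i => s (i, r)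

/-- Unfolding of `expMatrixCol`. [folklore] -/
@[simp]
theorem expMatrixCol_apply (s : Fin N × Fin N →₀ ℕ) (r i : Fin N) : expMatrixCol s r i = s (i, r) := by
  simp [expMatrixCol]

/-- A balanced exponent matrix (all column sums `δ`) is an `M_J`. [folklore] -/
theorem exists_colExp_eq {s : Fin N × Fin N →₀ ℕ} (hs : ∀ r : Fin N, ∑ i : Fin N, s (i, r) = δ) :
    ∃ J : Fin N → DegIdx (Fin N) δ, colExp J = s := by
  refine ⟨fun r => ⟨expMatrixCol s r, mem_degMonomials_iff.mpr ?_⟩, ?_⟩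
  · rw [Finsupp.degree_eq_sum]
    simp only [expMatrixCol_apply]
    exact hs r
  · ext v
    simp

/-- **A balanced polynomial is the sum of its `x^{M_J}`-terms.** [folklore] -/
theorem sum_monomial_colExp_coeff {G : MvPolynomial (Fin N × Fin N) k} (hG : IsBalanced N δ G) :
    ∑ J : Fin N → DegIdx (Fin N) δ, monomial (colExp J) (coeff (colExp J) G) = G := by
  classical
  rw [← Finset.sum_image (f := fun s => monomial s (coeff s G))
    (fun J _ J' _ h => colExp_injective h)]
  conv_rhs => rw [← G.support_sum_monomial_coeff]
  symm
  refine Finset.sum_subset (fun s hs => ?_) (fun s _ hs => ?_)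
  · obtain ⟨J, hJ⟩ := exists_colExp_eq ((isBalanced_iff N δ G).mp hG s hs)
    exact Finset.mem_image.mpr ⟨J, Finset.mem_univ _, hJ⟩
  · rw [notMem_support_iff.mp hs, monomial_zero]

/-- **`Θ ∘ Ξ = id` on balanced form-symmetric polynomials** (characteristic zero). [folklore] -/
theorem plethysmBridge_plethysmRestitution [CharZero k] {G : MvPolynomial (Fin N × Fin N) k}
    (hG : G ∈ symBalanced N δ) : plethysmBridge N δ (plethysmRestitution N δ G) = G := by
  rw [plethysmBridge_eq_sum_monomial]
  simp_rw [arrOf_plethysmRestitution hG.2, div_mul_cancel₀ _ (multCoef_ne_zero (k := k) _)]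
  exact sum_monomial_colExp_coeff hG.1

/-- Hence `Ξ(G) ≠ 0` for a nonzero balanced form-symmetric `G`. [folklore] -/
theorem plethysmRestitution_ne_zero [CharZero k] {G : MvPolynomial (Fin N × Fin N) k}
    (hG : G ∈ symBalanced N δ) (hG0 : G ≠ 0) : plethysmRestitution N δ G ≠ 0 := by
  intro h
  apply hG0
  rw [← plethysmBridge_plethysmRestitution hG, h, plethysmBridge_zero]

/-! ### `Θ` lands in `𝒪(V^N // H_N)_δ` -/

/-- `Θ(F)` is balanced of degree `δ` (every `x^{M_J}` has all column degrees `δ`). [folklore] -/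
theorem isBalanced_plethysmBridge (F : MvPolynomial (DegIdx (Fin N) δ) k) :
    IsBalanced N δ (plethysmBridge N δ F) := by
  rw [plethysmBridge_eq_sum_monomial]
  refine IsWeightedHomogeneous.sum _ _ _ fun J _ => isWeightedHomogeneous_monomial _ _ _ ?_
  funext j
  rw [weight_colWeight_apply, sum_colExp_apply]

/-- `Θ(F)` is form-symmetric (the array `A(F)` is symmetric). [folklore] -/
theorem isFormSymm_plethysmBridge (F : MvPolynomial (DegIdx (Fin N) δ) k) :
    IsFormSymm N (plethysmBridge N δ F) := by
  intro τ
  rw [plethysmBridge_eq_sum_monomial, map_sum]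
  simp_rw [rename_monomial, mapDomain_prodMap_colExp]
  refine (Fintype.sum_equiv (Equiv.arrowCongr τ.symm (Equiv.refl (DegIdx (Fin N) δ))) _ _
    fun J => ?_).symm
  have hJ : (Equiv.arrowCongr τ.symm (Equiv.refl (DegIdx (Fin N) δ))) J = J ∘ ⇑τ := by
    funext r
    simp [Equiv.arrowCongr_apply]
  have hJJ : (J ∘ ⇑τ) ∘ ⇑τ.symm = J := by
    funext r
    simp
  rw [hJ, hJJ, multCoef_comp_perm, arrOf_comp_perm]

/-- **`Θ(F) ∈ 𝒪(V^N // H_N)_δ = symBalanced N δ`.** [cite: BurgisserHuttenhainIkenmeyer2017, §3 (Lemma 4, (5))] -/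
theorem plethysmBridge_mem_symBalanced (F : MvPolynomial (DegIdx (Fin N) δ) k) :
    plethysmBridge N δ F ∈ symBalanced N δ :=
  ⟨isBalanced_plethysmBridge F, isFormSymm_plethysmBridge F⟩

/-! ### `Θ` is `GL_N`-equivariant -/

/-- **Equivariance of the plethysm bridge**: `Θ(g · F) = g · Θ(F)` for forms `F` of degree `N`
(the transformation law of the array, `arrOf_linSubst`, against the equivariance of the Veronese
pullbacks). [cite: BurgisserHuttenhainIkenmeyer2017, §3 (φ_n and ψ_n are G-equivariant)] -/
theorem plethysmBridge_coordSubst [CharZero k] (g : GL (Fin N) k)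
    {F : MvPolynomial (DegIdx (Fin N) δ) k} (hF : F.IsHomogeneous N) :
    plethysmBridge N δ (coordSubst δ g F) = formsRep N g (plethysmBridge N δ F) := by
  classical
  set M : Matrix (DegIdx (Fin N) δ) (DegIdx (Fin N) δ) k :=
    Matrix.of fun e d => coeff d.1 (linSubstRep (Fin N) k g⁻¹ (monomial e.1 (1 : k))) with hM
  have hcs : coordSubst δ g = linSubst (DegIdx (Fin N) δ) k M := coordSubst_eq_linSubst δ g
  set P : (Fin N → DegIdx (Fin N) δ) → MvPolynomial (Fin N × Fin N) k :=
    fun I => ∏ r : Fin N, veronesePullback N δ r (X (I r)) with hP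
  -- both sides equal `∑_I ∑_J C((∏_r M (I r) (J r)) · A(F)_J) · P_I`
  have lhs : plethysmBridge N δ (coordSubst δ g F) =
      ∑ I : Fin N → DegIdx (Fin N) δ, ∑ J : Fin N → DegIdx (Fin N) δ,
        C ((∏ r, M (I r) (J r)) * arrOf N F J) * P I := by
    unfold plethysmBridge
    refine Finset.sum_congr rfl fun I _ => ?_
    rw [hcs, arrOf_linSubst M hF I, map_sum, Finset.sum_mul]
  have rhs : formsRep N g (plethysmBridge N δ F) =
      ∑ J : Fin N → DegIdx (Fin N) δ, ∑ I : Fin N → DegIdx (Fin N) δ,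
        C ((∏ r, M (I r) (J r)) * arrOf N F J) * P I := by
    unfold plethysmBridge
    rw [map_sum]
    refine Finset.sum_congr rfl fun J _ => ?_
    rw [formsRep_apply, map_mul, linSubst_C, map_prod]
    have h1 : ∀ r : Fin N, linSubst (Fin N × Fin N) k
        ((formsBlockGL N g : GL (Fin N × Fin N) k) : Matrix _ _ k) (veronesePullback N δ r (X (J r))) =
        ∑ e : DegIdx (Fin N) δ, C (M e (J r)) * veronesePullback N δ r (X e) := by
      intro r
      rw [← formsRep_apply, ← veronesePullback_coordSubst, hcs, linSubst_X, map_sum]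
      refine Finset.sum_congr rfl fun e _ => ?_
      rw [map_smul, smul_eq_C_mul]
    simp_rw [h1]
    rw [Finset.prod_univ_sum]
    simp only [Fintype.piFinset_univ]
    rw [Finset.mul_sum]
    refine Finset.sum_congr rfl fun I _ => ?_
    rw [Finset.prod_mul_distrib, ← map_prod, ← mul_assoc, ← map_mul, mul_comm (arrOf N F J)]
  rw [lhs, rhs, Finset.sum_comm]

/-! ### Highest-weight vectors correspond under the bridge -/

/-- **`Θ` carries highest-weight vectors (forms of degree `N`) to highest-weight vectors of the same
weight.** [cite: BurgisserHuttenhainIkenmeyer2017, §3 (Lemma 4)] -/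
theorem plethysmBridge_mem_highestWeightSpace [CharZero k] {χ : Weight (Fin N)}
    {F : MvPolynomial (DegIdx (Fin N) δ) k} (hF : F ∈ highestWeightSpace (coordRep (Fin N) k δ) χ)
    (hhom : F.IsHomogeneous N) :
    plethysmBridge N δ F ∈ highestWeightSpace (formsRep N) χ := by
  intro b hb
  have h := hF b hb
  rw [coordRep_apply] at h
  rw [← plethysmBridge_coordSubst b hhom, h, plethysmBridge_smul]

/-- **`Ξ` carries balanced form-symmetric highest-weight vectors to highest-weight vectors of the
same weight** (`Θ` is injective on forms of degree `N` and `Θ ∘ Ξ = id`). [cite: BurgisserHuttenhainIkenmeyer2017, §3 (Lemma 4)] -/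
theorem plethysmRestitution_mem_highestWeightSpace [CharZero k] {χ : Weight (Fin N)}
    {G : MvPolynomial (Fin N × Fin N) k} (hG : G ∈ symBalanced N δ)
    (hGw : G ∈ highestWeightSpace (formsRep N) χ) :
    plethysmRestitution N δ G ∈ highestWeightSpace (coordRep (Fin N) k δ) χ := by
  intro b hb
  rw [coordRep_apply]
  have hhom := isHomogeneous_plethysmRestitution (N := N) (δ := δ) G
  have h1 : plethysmBridge N δ (coordSubst δ b (plethysmRestitution N δ G)) =
      plethysmBridge N δ (weightChar χ b • plethysmRestitution N δ G) := by
    rw [plethysmBridge_coordSubst b hhom, plethysmBridge_plethysmRestitution hG, hGw b hb,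
      plethysmBridge_smul, plethysmBridge_plethysmRestitution hG]
  have h2 := congrArg (plethysmRestitution N δ) h1
  rwa [plethysmRestitution_plethysmBridge (isHomogeneous_coordSubst b hhom),
    plethysmRestitution_plethysmBridge] at h2
  exact (homogeneousSubmodule _ k N).smul_mem _ hhom

/-- **The two models of "`λ` occurs in `Sym^N Sym^δ V`" agree, I**: a nonzero highest-weight vector
of weight `χ` among the forms of degree `N` on `Sym^δ k^N` (`coordRep`) yields a realisation of `χ`
in `𝒪(V^N // H_N)_δ` (`IsRealized`, `formsRep`). [cite: BurgisserHuttenhainIkenmeyer2017, Lemma 4] -/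
theorem isRealized_of_mem_highestWeightSpace_coordRep [CharZero k] {χ : Weight (Fin N)}
    {F : MvPolynomial (DegIdx (Fin N) δ) k} (hF : F ∈ highestWeightSpace (coordRep (Fin N) k δ) χ)
    (hhom : F.IsHomogeneous N) (hF0 : F ≠ 0) : IsRealized k N δ χ :=
  ⟨plethysmBridge N δ F, plethysmBridge_ne_zero hhom hF0, plethysmBridge_mem_symBalanced F,
    plethysmBridge_mem_highestWeightSpace hF hhom⟩

/-- **The two models agree, II**: a weight realised in `𝒪(V^N // H_N)_δ` has a nonzero
highest-weight vector among the forms of degree `N` on `Sym^δ k^N`.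
[cite: BurgisserHuttenhainIkenmeyer2017, Lemma 4] -/
theorem exists_mem_highestWeightSpace_coordRep_of_isRealized [CharZero k] {χ : Weight (Fin N)}
    (h : IsRealized k N δ χ) :
    ∃ F ∈ highestWeightSpace (coordRep (Fin N) k δ) χ, F.IsHomogeneous N ∧ F ≠ 0 := by
  obtain ⟨G, hG0, hG, hGw⟩ := h
  exact ⟨plethysmRestitution N δ G, plethysmRestitution_mem_highestWeightSpace hG hGw,
    isHomogeneous_plethysmRestitution G, plethysmRestitution_ne_zero hG hG0⟩

/-! ### Lifting highest-weight vectors from `k[Chow_m]` -/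

/-- **Highest-weight vectors of a coordinate ring `k[Δ_m[f]]` lift to `k[Sym^m]`** (characteristic
zero): a highest weight of the quotient `k[Sym^m] / I(GL · f)` is carried by a highest-weight vector
of `k[Sym^m]` outside the ideal (complete reducibility of `k[Sym^m]`,
`isSemisimpleRepresentation_coordRep`, `map_highestWeightSpace_eq_of_surjective`). BHI §1, after (1):
"Schur's lemma implies that `S(Z)` can also be characterized as the set of highest weights of the
irreducible `G`-modules occuring in `𝒪(W)`" whose highest-weight vectors do not vanish on `Z`.
[cite: BurgisserHuttenhainIkenmeyer2017, §1 (after (1))] -/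
theorem exists_mem_highestWeightSpace_not_mem_of_hasHighestWeight [CharZero k] {σ : Type*}
    [Fintype σ] [LinearOrder σ] (f : MvPolynomial σ k) (m : ℕ) {χ : Weight σ}
    (h : HasHighestWeight (orbitCoordRep f m) χ) :
    ∃ F ∈ highestWeightSpace (coordRep σ k m) χ, F ∉ orbitVanishingIdeal f m := by
  obtain ⟨x, hx0, hx⟩ := (hasHighestWeight_iff_exists _ _).mp h
  have hsurj : Function.Surjective (mkIntertwiningMap f m) := Ideal.Quotient.mk_surjective
  have hmap := map_highestWeightSpace_eq_of_surjective (mkIntertwiningMap f m) hsurj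
    (isSemisimpleRepresentation_coordRep m) χ
  rw [← hmap] at hx
  obtain ⟨F, hF, hFx⟩ := Submodule.mem_map.mp hx
  refine ⟨F, hF, fun hI => hx0 ?_⟩
  rw [← hFx]
  exact Ideal.Quotient.eq_zero_iff_mem.mpr hI

end Literature.Computability.AlgebraicComplexity
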